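import Mathlib
import HarnessLib
import Summits.HubbardSuperconductivity.HubbardSuperconductivity.Theorems.KLProgrammeKLRegimeFlowReadTransport
import Summits.HubbardSuperconductivity.HubbardSuperconductivity.Theorems.KLProgrammeKLRegimeSplitTwoLegSizesMSDiffProfileSizes
import Summits.HubbardSuperconductivity.HubbardSuperconductivity.Theorems.KLProgrammePerturbedFermiCurveHigherDerivsBand
import Summits.HubbardSuperconductivity.HubbardSuperconductivity.Theorems.KLProgrammeKLRegimeSplitCounterMap

/-!
# Route `KLProgramme`, crux K3 — gen-8 ENGINE-FLOW child (stmt-HubbardSuperconductivity-20437 `KLRegimeEngineV17F2`), stub (C)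
# `stub_twoLeg_curvature`: «(C2)-FIT», part 3 — the (C2) door's symbol sizes `hF, hM₁…hM₅` from the SPLIT `ν̃_n = K_n + S̃_n`
# (frame jets in momentum space + separated-symbol jets), and the fitted door keyed on the split

Seat hubbard-kl-k3c3-p1 (g9).  The (C2) door reads `hF : ContDiff ℝ 5 F` and NESTED sizes `‖fderiv^{(j)} F‖ ≤ M_j` of the cumulative symbol
`F = q ↦ (symInterp L (klLocSelfEnergyRe … K_n n)).eval q`.  By exact reproduction of the frame (`eval_symInterp_latticeValues_of_degree_le`, degree
guard `K_n.degree ≤ L/2`) and linearity of the interpolant, `F = evalM K_n + evalM (symInterp L S̃)` with the K_n-SEPARATED data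
`S̃ k = klLocSelfEnergyRe … K_n n k − K_n(p_k)` — and the two parts are sized by different routes (KL STATUS 2026-08-28 l.≈4424, (†)): the frame in
MOMENTUM space (`FlowPieceJetsAt` / `…FlowPieceJetsAllOrders` ⇒ `‖Dʲ evalM K_n‖ ≤ a j`), the separated symbol in POSITION space (located risk #17's
atom ⇒ p1b's bridge ⇒ `norm_iteratedFDeriv_evalM_le_coeffNorm` ⇒ `‖Dʲ evalM (symInterp L S̃)‖ ≤ b j`).

* `cumulativeSymbol_eq_frame_add_sep` — `F = evalM K_n + evalM (symInterp L S̃)` (degree guard);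
* `cumulativeSymbol_contDiff` — `F` is `C^∞`;
* **`cumulativeSymbol_nested_sizes_of_split`** — `a j + b j` bound the door's five NESTED sizes (`norm_fderiv_…_eq_norm_iteratedFDeriv` conversions);
* USE: `obtain ⟨h1, h2, h3, h4, h5⟩ := cumulativeSymbol_nested_sizes_of_split β U μ hdeg n ha hb` then
  `transport_jets_flow_fit … (cumulativeSymbol_contDiff β U μ _ n) h1 h2 h3 h4 h5 hm hlaw1 … hlaw5` with the moment law stated on `M_j := a j + b j`
  (a one-call wrapper is a restatement of `transport_jets_flow_fit` for the dedup lint, hence not a separate theorem).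

Proofs only; no definitions; nothing here asserts superconductivity.
-/

noncomputable section

namespace Summit.HubbardSuperconductivity.HubbardSuperconductivity.Theorems.KLRegimeSplit

set_option linter.dupNamespace false -- summit = problem name (single-conjunct summit), D-0017
set_option maxSynthPendingDepth 4 -- nested operator-norm instances (fifth Fréchet derivatives), as in the door

open Real Literature.MathematicalPhysics.QuantumLattice Literature.Probability.LatticeModels
open Summit.HubbardSuperconductivity.HubbardSuperconductivity.Theorems.PerturbedFermiCurve

section Split

variable {L M : ℕ} [NeZero L] [NeZero M]

/-- **`F = evalM K + evalM (symInterp L S̃)`** for a frame of degree `≤ L/2`: the cumulative symbol splits into the frame and the interpolant of the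
`K`-separated data, at every momentum. -/
theorem cumulativeSymbol_eq_frame_add_sep (β U μ : ℝ) {K : TrigPolyC4v} (hK : K.degree ≤ L / 2) (n : ℕ) :
    (fun q : Momentum => (symInterp L (klLocSelfEnergyRe L M β U μ K n)).eval (WithLp.ofLp q)) =
      fun q : Momentum => evalM K q + evalM (symInterp L (fun k => klLocSelfEnergyRe L M β U μ K n k - K.eval (latticeMomentum L k))) q := by
  funext q
  have hsplit : (fun k => klLocSelfEnergyRe L M β U μ K n k) =
      fun k => K.eval (latticeMomentum L k) + (klLocSelfEnergyRe L M β U μ K n k - K.eval (latticeMomentum L k)) := by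
    funext k; ring
  rw [evalM_apply, evalM_apply, show symInterp L (klLocSelfEnergyRe L M β U μ K n) = symInterp L (fun k => klLocSelfEnergyRe L M β U μ K n k) from rfl,
    hsplit, eval_symInterp_add, eval_symInterp_latticeValues_of_degree_le L K hK]

/-- The cumulative symbol is `C^∞` (a trigonometric polynomial). -/
theorem cumulativeSymbol_contDiff (β U μ : ℝ) (K : TrigPolyC4v) (n : ℕ) {k : WithTop ℕ∞} :
    ContDiff ℝ k (fun q : Momentum => (symInterp L (klLocSelfEnergyRe L M β U μ K n)).eval (WithLp.ofLp q)) :=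
  contDiff_evalM (symInterp L (klLocSelfEnergyRe L M β U μ K n))

/-- **THE DOOR'S NESTED SIZES FROM THE SPLIT.**  If `‖Dʲ evalM K‖ ≤ a j` and `‖Dʲ evalM (symInterp L S̃)‖ ≤ b j` for `1 ≤ j ≤ 5` (iterated Fréchet
derivatives, every momentum), then the five nested sizes the (C2) door reads hold with `M_j := a j + b j`. -/
theorem cumulativeSymbol_nested_sizes_of_split (β U μ : ℝ) {K : TrigPolyC4v} (hK : K.degree ≤ L / 2) (n : ℕ) {a b : ℕ → ℝ}
    (ha : ∀ j, 1 ≤ j → j ≤ 5 → ∀ q : Momentum, ‖iteratedFDeriv ℝ j (evalM K) q‖ ≤ a j)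
    (hb : ∀ j, 1 ≤ j → j ≤ 5 → ∀ q : Momentum,
      ‖iteratedFDeriv ℝ j (evalM (symInterp L (fun k => klLocSelfEnergyRe L M β U μ K n k - K.eval (latticeMomentum L k)))) q‖ ≤ b j) :
    (∀ z, ‖fderiv ℝ (fun q : Momentum => (symInterp L (klLocSelfEnergyRe L M β U μ K n)).eval (WithLp.ofLp q)) z‖ ≤ a 1 + b 1) ∧
    (∀ z, ‖fderiv ℝ (fderiv ℝ (fun q : Momentum => (symInterp L (klLocSelfEnergyRe L M β U μ K n)).eval (WithLp.ofLp q))) z‖ ≤ a 2 + b 2) ∧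
    (∀ z, ‖fderiv ℝ (fderiv ℝ (fderiv ℝ (fun q : Momentum => (symInterp L (klLocSelfEnergyRe L M β U μ K n)).eval (WithLp.ofLp q)))) z‖ ≤
      a 3 + b 3) ∧
    (∀ z, ‖fderiv ℝ (fderiv ℝ (fderiv ℝ (fderiv ℝ (fun q : Momentum =>
      (symInterp L (klLocSelfEnergyRe L M β U μ K n)).eval (WithLp.ofLp q))))) z‖ ≤ a 4 + b 4) ∧
    (∀ z, ‖fderiv ℝ (fderiv ℝ (fderiv ℝ (fderiv ℝ (fderiv ℝ (fun q : Momentum =>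
      (symInterp L (klLocSelfEnergyRe L M β U μ K n)).eval (WithLp.ofLp q)))))) z‖ ≤ a 5 + b 5) := by
  set G : Momentum → ℝ := evalM (symInterp L (fun k => klLocSelfEnergyRe L M β U μ K n k - K.eval (latticeMomentum L k))) with hG
  have hF : (fun q : Momentum => (symInterp L (klLocSelfEnergyRe L M β U μ K n)).eval (WithLp.ofLp q)) = fun q => evalM K q + G q :=
    cumulativeSymbol_eq_frame_add_sep β U μ hK n
  -- iterated derivative of the sum, any order
  have hsum : ∀ j, 1 ≤ j → j ≤ 5 → ∀ z : Momentum,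
      ‖iteratedFDeriv ℝ j (fun q : Momentum => (symInterp L (klLocSelfEnergyRe L M β U μ K n)).eval (WithLp.ofLp q)) z‖ ≤ a j + b j := by
    intro j hj1 hj5 z
    rw [hF, show (fun q => evalM K q + G q) = evalM K + G from rfl,
      iteratedFDeriv_add_apply (contDiff_evalM K (k := (j : ℕ∞))).contDiffAt ((contDiff_evalM _ (k := (j : ℕ∞))).contDiffAt (x := z))]
    exact (norm_add_le _ _).trans (add_le_add (ha j hj1 hj5 z) (hb j hj1 hj5 z))
  refine ⟨fun z => ?_, fun z => ?_, fun z => ?_, fun z => ?_, fun z => ?_⟩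
  · rw [norm_fderiv_eq_norm_iteratedFDeriv_one]; exact hsum 1 le_rfl (by norm_num) z
  · rw [norm_fderiv_two_eq_norm_iteratedFDeriv]; exact hsum 2 (by norm_num) (by norm_num) z
  · rw [norm_fderiv_three_eq_norm_iteratedFDeriv]; exact hsum 3 (by norm_num) (by norm_num) z
  · rw [norm_fderiv_four_eq_norm_iteratedFDeriv]; exact hsum 4 (by norm_num) (by norm_num) z
  · rw [norm_fderiv_five_eq_norm_iteratedFDeriv]; exact hsum 5 (by norm_num) (by norm_num) z

end Split

end Summit.HubbardSuperconductivity.HubbardSuperconductivity.Theorems.KLRegimeSplit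

end
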